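import Summits.Ventures.PercRepro2.CaseOneCoreTM

/-!
# The residual core with the faces of the anchors
(blind cell PercRepro2, p1 g32)

Every absent-edge face of a six-form closed graph is six-form closed (`closedAtT_of_ext`,
CaseOneMovesT), so every instance that becomes an anchor once finitely many absent edges are added is
six-form closed: `FaceAnchor Anc` (one added edge `s`: the extension `(Option E, extEnds ends s)` is an
`Anc` instance), its iterates `FaceAnchorN Anc n`, **`closedAtT_of_faceAnchorN`**, and the anchor set
`ClosedAnchorTF := ∃ n, FaceAnchorN ClosedAnchorTM n` — the closed anchors of the four-form calculus,
the marks-only vertices, and all their faces (for instance the uwob gadget with its `b`-edge or its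
`o`-edge deleted: `v ~ {w, o}` or `v ~ {w, b}` with `w ~ {v, a₁, a₂}`). The `a₂`-free residual core
`InCoreTF` relative to it and the reduction **`closedAtT_of_coreTF`** / `closedAt_of_coreTF`;
`InCoreTM.of_inCoreTF` (the core only shrank). Own code; standard axioms. -/

namespace Summit.Ventures.PercRepro2

namespace CaseOne

universe u

section Faces
variable {V : Type*}

/-- **The faces of an anchor predicate**: `(E, ends, v)` is an `Anc` instance once the absent edge `s`
is added (`extEnds ends s` on `Option E`, the new edge `none`). -/
def FaceAnchor (Anc : ∀ (E₀ : Type u) [Fintype E₀] [DecidableEq E₀], (E₀ → Sym2 V) → V → Prop)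
    (E : Type u) [Fintype E] [DecidableEq E] (ends : E → Sym2 V) (v : V) : Prop :=
  ∃ s : Sym2 V, Anc (Option E) (extEnds ends s) v

/-- The `n`-fold faces of an anchor predicate: `n` absent edges added. -/
def FaceAnchorN (Anc : ∀ (E₀ : Type u) [Fintype E₀] [DecidableEq E₀], (E₀ → Sym2 V) → V → Prop) :
    ℕ → ∀ (E₀ : Type u) [Fintype E₀] [DecidableEq E₀], (E₀ → Sym2 V) → V → Prop
  | 0 => Anc
  | n + 1 => fun E₀ _ _ ends₀ v₀ => FaceAnchor (FaceAnchorN Anc n) E₀ ends₀ v₀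

variable (o a₁ a₂ b : V) {R : Type*} [Field R] [LinearOrder R] [IsStrictOrderedRing R]

/-- **A face of a six-form closed anchor is six-form closed** (`closedAtT_of_ext`). -/
theorem closedAtT_of_faceAnchor
    (Anc : ∀ (E₀ : Type u) [Fintype E₀] [DecidableEq E₀], (E₀ → Sym2 V) → V → Prop)
    (hanc : ∀ (E₀ : Type u) [Fintype E₀] [DecidableEq E₀] (ends₀ : E₀ → Sym2 V) (v₀ : V),
      Anc E₀ ends₀ v₀ → ClosedAtT (R := R) o a₁ a₂ b E₀ ends₀ v₀)
    (E : Type u) [Fintype E] [DecidableEq E] (ends : E → Sym2 V) (v : V)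
    (h : FaceAnchor Anc E ends v) : ClosedAtT (R := R) o a₁ a₂ b E ends v := by
  obtain ⟨s, hs⟩ := h
  exact closedAtT_of_ext (hanc (Option E) (extEnds ends s) v hs)

/-- **Every iterated face of a six-form closed anchor is six-form closed.** -/
theorem closedAtT_of_faceAnchorN
    (Anc : ∀ (E₀ : Type u) [Fintype E₀] [DecidableEq E₀], (E₀ → Sym2 V) → V → Prop)
    (hanc : ∀ (E₀ : Type u) [Fintype E₀] [DecidableEq E₀] (ends₀ : E₀ → Sym2 V) (v₀ : V),
      Anc E₀ ends₀ v₀ → ClosedAtT (R := R) o a₁ a₂ b E₀ ends₀ v₀) :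
    ∀ (n : ℕ) (E : Type u) [Fintype E] [DecidableEq E] (ends : E → Sym2 V) (v : V),
      FaceAnchorN Anc n E ends v → ClosedAtT (R := R) o a₁ a₂ b E ends v := by
  intro n
  induction n with
  | zero => exact fun E _ _ ends v h => hanc E ends v h
  | succ n ih =>
    intro E _ _ ends v h
    exact closedAtT_of_faceAnchor o a₁ a₂ b (FaceAnchorN Anc n) (fun E₀ _ _ ends₀ v₀ h₀ => ih E₀ ends₀ v₀ h₀)
      E ends v h

end Faces

section AnchorsTF
variable {V : Type*}

/-- **The anchors of the six-form calculus with their faces**: a `ClosedAnchorTM` instance (a closed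
anchor of the four-form calculus or a marks-only vertex) with finitely many absent edges added. -/
def ClosedAnchorTF (o a₁ a₂ b : V) (E : Type u) [Fintype E] [DecidableEq E] (ends : E → Sym2 V)
    (v : V) : Prop :=
  ∃ n : ℕ, FaceAnchorN (fun E₀ _ _ ends₀ v₀ => ClosedAnchorTM o a₁ a₂ b E₀ ends₀ v₀) n E ends v

variable (o a₁ a₂ b : V)

/-- A `ClosedAnchorTM` anchor is a `ClosedAnchorTF` anchor (no face taken). -/
theorem ClosedAnchorTF.of_closedAnchorTM (E : Type u) [Fintype E] [DecidableEq E]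
    (ends : E → Sym2 V) (v : V) (h : ClosedAnchorTM o a₁ a₂ b E ends v) :
    ClosedAnchorTF o a₁ a₂ b E ends v :=
  ⟨0, h⟩

variable [Fintype V] [DecidableEq V] {R : Type*} [Field R] [LinearOrder R] [IsStrictOrderedRing R]

/-- **A `ClosedAnchorTF` anchor is six-form closed.** -/
theorem closedAtT_of_closedAnchorTF (E : Type u) [Fintype E] [DecidableEq E] (ends : E → Sym2 V)
    (v : V) (h : ClosedAnchorTF o a₁ a₂ b E ends v) : ClosedAtT (R := R) o a₁ a₂ b E ends v := by
  obtain ⟨n, hn⟩ := h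
  exact closedAtT_of_faceAnchorN o a₁ a₂ b _
    (fun E₀ _ _ ends₀ v₀ h₀ => closedAtT_of_closedAnchorTM o a₁ a₂ b E₀ ends₀ v₀ h₀) n E ends v hn

variable (v : V)

/-- **The `a₂`-free residual core relative to the anchors and their faces.** -/
def InCoreTF (E : Type u) [Fintype E] [DecidableEq E] (ends : E → Sym2 V) : Prop :=
  InCoreTAnc o a₁ a₂ b v (fun E₀ _ _ ends₀ v₀ => ClosedAnchorTF o a₁ a₂ b E₀ ends₀ v₀) E ends

/-- **The reduction to the `a₂`-free residual core relative to the anchors and their faces.** -/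
theorem closedAtT_of_coreTF
    (hcore : ∀ (E' : Type u) [Fintype E'] [DecidableEq E'] (ends' : E' → Sym2 V),
      InCoreTF o a₁ a₂ b v E' ends' → ClosedAtT (R := R) o a₁ a₂ b E' ends' v) :
    ∀ (E : Type u) [Fintype E] [DecidableEq E] (ends : E → Sym2 V),
      ClosedAtT (R := R) o a₁ a₂ b E ends v :=
  closedAtT_of_coreTAnc o a₁ a₂ b v _
    (fun E₀ _ _ ends₀ v₀ h => closedAtT_of_closedAnchorTF o a₁ a₂ b E₀ ends₀ v₀ h) hcore

/-- **The four forms everywhere from the six forms on `InCoreTF`.** -/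
theorem closedAt_of_coreTF
    (hcore : ∀ (E' : Type u) [Fintype E'] [DecidableEq E'] (ends' : E' → Sym2 V),
      InCoreTF o a₁ a₂ b v E' ends' → ClosedAtT (R := R) o a₁ a₂ b E' ends' v)
    (E : Type u) [Fintype E] [DecidableEq E] (ends : E → Sym2 V) : ClosedAt R o a₁ a₂ b E ends v :=
  closedAt_of_closedAtT (closedAtT_of_coreTF o a₁ a₂ b v hcore E ends)

end AnchorsTF

section CoreTFProps
variable {V : Type*} (o a₁ a₂ b v : V)

/-- An `InCoreTF` instance is an `InCoreTM` instance (the anchor set only grew). -/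
theorem InCoreTM.of_inCoreTF (E : Type u) [Fintype E] [DecidableEq E] (ends : E → Sym2 V)
    (h : InCoreTF o a₁ a₂ b v E ends) : InCoreTM o a₁ a₂ b v E ends := by
  obtain ⟨hres, ha2, hreach⟩ := h
  refine ⟨hres, ha2, fun hr => hreach ?_⟩
  obtain ⟨E₀, _, _, ends₀, v₀, hanc, hmv⟩ := hr
  exact ⟨E₀, inferInstance, inferInstance, ends₀, v₀, ClosedAnchorTF.of_closedAnchorTM o a₁ a₂ b E₀ ends₀ v₀ hanc, hmv⟩

/-- **On an `InCoreTF` instance the statement vertex has an unmarked neighbour** and no `a₂`-edge. -/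
theorem InCoreTF.exists_unmarked_edge (E : Type u) [Fintype E] [DecidableEq E] (ends : E → Sym2 V)
    (h : InCoreTF o a₁ a₂ b v E ends) :
    (∃ e, v ∈ ends e ∧ ends e ≠ s(a₁, v) ∧ ends e ≠ s(a₂, v) ∧ ends e ≠ s(o, v) ∧ ends e ≠ s(b, v)) ∧
      ∀ e, ends e ≠ s(a₂, v) :=
  ⟨InCoreTM.exists_unmarked_edge o a₁ a₂ b v E ends (InCoreTM.of_inCoreTF o a₁ a₂ b v E ends h),
    InCoreTM.no_a2_edge o a₁ a₂ b v E ends (InCoreTM.of_inCoreTF o a₁ a₂ b v E ends h)⟩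

end CoreTFProps

end CaseOne

end Summit.Ventures.PercRepro2
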